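import Literature.MathematicalPhysics.QuantumFieldTheory.Balaban1983to89.B8Thm2TorusLettersAllPerOfKnit
import Literature.MathematicalPhysics.QuantumFieldTheory.Balaban1983to89.B9B8KnitLetterHprimeLap

/-!
# `Balaban1983to89.B8Thm2TorusKnitEstimatesOfMajorants` — M5.9 ASSEMBLY, FILE A4: the estimate bundle `KnitEstimates` of the v3 letters of
# [Balaban1985RegularSpaces] Thm 2 on `T_η` ((E6)–(E8) = (1.92) for `H′`, (E12) = (1.101) for `G′`, (E15) = (1.98) for `R`) READ OFF the junction's
# [Balaban1985BackgroundPropagators] Thm 3.1 ∕ 3.2-type BLOCK MAJORANTS at print's transporters — the norms dictionary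

statement-level skeleton of published theorems with citation tags; proofs where landed; nothing here is a claim about the
Yang–Mills mass gap

T. Bałaban, *Spaces of regular gauge field configurations on a lattice and gauge fixing conditions*, Commun. Math. Phys. **99** (1985) 75–102
[`Balaban1985RegularSpaces`, "[B8]"]: (1.91)–(1.92) p. 91 (`H′ = G′²Q′*(Q′G′²Q′*)⁻¹`; *«|H′X|, |∇_{U₀}H′X|₍₁₎, |Δ_{U₀}H′X|₍₋₂₎ ≦ B₀′|X|»*), (1.98) p. 92 (`R = I − G′Q′ᵀCQ′G′`,
`|Rf|₍₋₂₎ ≦ B_R|f|₍₋₂₎`), (1.101) p. 93 (*«|G′f|, |∇_{U₀}G′f|₍₁₎ ≦ B_G|f|₍₋₂₎»*), p. 86 (the norms `|·|₍₋₂₎`, `|·|₍₁₎` after (1.55)), (1.59) p. 86, p. 77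
(*«we admit the case where some domains Ω_j are equal to T_η»*).  T. Bałaban, *Propagators for lattice gauge theories in a background field*, Commun. Math. Phys.
**99** (1985) 389–434 [`Balaban1985BackgroundPropagators`, "[4]"]: Thm 3.1 (3.42) p. 397, (3.47) p. 398 (*«the global inequalities (3.47) are consequences of the
local ones (3.42) and Lemma 2.1»*), Thm 3.2 (3.48) p. 398, (3.49) p. 399, (3.19)–(3.25) pp. 393–395.  T. Bałaban, *Propagators and renormalization
transformations for lattice gauge theories. II*, Commun. Math. Phys. **96** (1984) 223–250 [`Balaban1984PropagatorsII`]: (2.51)–(2.52) p. 232, (2.61) p. 234.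
STATUS: published, refereed.

CITATION HEADER (lean-in-tree rule).  Cell `lit-balaban`, seat `lit-balaban-t2s-1` (gen 4), MODULE M5.9 of the G-B9-LETTERS map of record, file A4; sub-row
G-B8-T2S (R3 `stmt-QuantumFields-19200`, helper).  CONSUMED BY NAME (junction J-B, seat p33 gens 94–95): file 11 `B9B8KnitLetterE12Sup.norm_GpKnitY_apply_le` ∕
`wt_norm_covDerivFwd_liftFun_le` ((E12)), file 18 `B9B8KnitLetterHprimeBounds.knit_E6_constLev` ∕ `knit_E7_constLev'` ((E6)∕(E7)), file 19
`B9B8KnitLetterHprimeLap.knit_E8_constLev` ((E8)), file 17 `B9B8KnitLetterRBound.knit_E15_constLev` ((E15)), file 12 `B9B8KnitLetterProjectionC.RY_parKnitY_smul`;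
junction J-A `B9B8CarrierDictionary.covDerivFwd_liftY` ∕ `covLap_liftY`; files A1–A3 of this seat (`B9B8KnitLetterTransfer`, `B8Thm2TorusLettersPerOfKnit`,
`B8Thm2TorusLettersAllPerOfKnit`).

WHY THIS FILE ∕ THE ARGUMENT.  Files A2–A3 construct the consumer's v3 letter bundle and its binder from [4]'s objects at print's transporters, MODULO the estimate
bundle `KnitEstimates` — the six printed inequalities for these objects, stated in the consumer's currency (sup norms on `ℤ^{d+1}`, the weights `Lʲη` of
`|·|₍₁₎`, `|·|₍₋₂₎` p. 86, periodic arguments, `XSpace`).  The junction proves (E6)–(E8), (E12), (E15) at each constant-level member in def-Y's currency (box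
sites, `max‖Y‖`, `(Lⁿη)²‖Λ‖ ≤ r`) from DISPLAYED block majorants of [4] Thm 3.1 ∕ 3.2 type — the output shapes of M5.5 ((3.42)₁: `conj b(η_S²G′) ≺ Aℓ²e^{−δd}`,
(3.42)₂: `conj b(η_S⁻¹∇_μ)·conj b(η_S²G′) ≺ A₁ℓe^{−δd}`) and M5.6 ((3.48): `conj b(s(Q′G′²Q′*)⁻¹) ≺ Kℓ⁻⁴e^{−δd}`) at `parKnitY` — plus the member's geometry
(`Triangle254`, `Ineq261`, row sums (2.61)) and a real basis `b` of `M_N(ℂ)` with coordinate constant `M₂`.  THIS FILE is the dictionary between the two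
currencies: `|f|₍₋₂₎ ≤ r` on `T_η` at level `n` IS `(Lⁿη)²‖f(w)‖ ≤ r` at the box sites (`bd2_descL`); `‖X‖_{XSpace} ≥ ‖X(n, ·)‖` (`norm_descXL_le`); the consumer's
`D^η_{U₀,μ}` ∕ `Δ^η_{U₀}` of a lifted box function are `η⁻¹∇_{U,μ}` ∕ `η⁻²Δ_U` at the charted point (J-A); `R` is blind to the units of `G′` (J-B 12).  Hence
★★★ `knitEstimates_of_majorants`: AT ONE BACKGROUND of the class (1.7), the bundle `KnitEstimates` for the family of file A3 follows from the displayed majorant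
package `KnitMajorants` at each member `n ≤ m` (background `U₀` read on member `n`'s box), uniform constants `KnitConstants`, four explicit threshold
inequalities naming `B_G, B₀′ᴴ, B₂′, B_R` in terms of `Σ‖b_j‖, M₂, A, A₁, K, c₁(d₁, δ₀, βₓ), c`, and the (B)-line (Prop. 3's in-edge (1.59), displayed verbatim as
the predicate `B9P3PerAt` — it involves no letter of [4]; sub-rows M5.7∕M5.8).

WHAT THIS FILE PROVES (sorry-free; definitions: the predicate `B9P3PerAt` and the two hypothesis bundles `KnitConstants`, `KnitMajorants` (structures of
`Prop`s, displayed inputs); no estimate of [B8]∕[4] asserted).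
* §1 dictionary lemmas: `bd2_descL`, `wt_sq_le_wt_sq`, `norm_descXL_le`, `sum_exp_le_of_rate_le` (row sum at the larger rate), `RY_knit_apply` (`rfl`).
* §2 `B9P3PerAt` (the (B)-line of `LettersAtPer`∕`KnitEstimates`, verbatim), `KnitConstants`, `KnitMajorants`, `KnitMajorants.hrow_delta`.
* §3 ★★★ **`knitEstimates_of_majorants`** — `KnitEstimates mem η U₀ (knitLettersY_familyOfInAk …) (ℓ+1) B_G B_R B₀′ᴴ B₂′ B₀ B₀β c_B β len α₀ P` from the displayed
  majorants at the members `n ≤ m`, for `G ≤ U(N)` averaging-closed, a `G`-valued `P`-periodic `U₀ ∈ 𝔄_m(T_η, α₀)` below [B7] Prop. 2's thresholds, `η > 0`.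
* §4 ★★★ `knitEstimates_familyAt_of_majorants` (the same for file A3's `knitLettersY_familyAt` at every truncation `m ≤ k` ∕ regularity `α₀ ≤ c_L` ∕ background, from
  majorants displayed per member-and-background), ★★★★ **`lettersAllPer_ofMajorants`** (the binder `LettersAllPer (ℓ+1) … c_L η k P G` from the majorant packages and
  the (B)-lines alone) and ★★★★★ **`thm2TorusAt_specialUnitary_ofMajorants`** — the G-B8-T2S endpoint composed all the way: [B8] Thm 2 on `T_η` for `SU(N)`, `N ≤ 25`,
  GIVEN a catalogue of constant-level members, [4] Thm 3.1∕3.2-type block majorants of `η_S²G′`, `η_S⁻¹∇·η_S²G′`, `s(Q′G′²Q′*)⁻¹` at print's transporters for every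
  member and background of the class, the (B)-lines, and the trace laws — the remaining displayed inputs of sub-row G-B8-T2S named in M5.5 ∕ M5.6 ∕ M5.7–8's
  own output shapes.

HONEST SCOPE.  Bookkeeping between currencies; NO estimate of [B8]∕[4] is proved: the block majorants (M5.5∕M5.6 at `parKnitY`, junction files 9∕10∕15∕16∕20),
the geometry facts, the (B)-line and the trace laws are displayed hypotheses, inhabited by nothing here; member family displayed; count-neutral; N05 ∕ `stub_PV3A`
NOT discharged; nothing continuum ∕ ℝ⁴ ∕ OS ∕ mass-gap ∕ Clay — the Yang–Mills mass gap is NOT proved.  No `sorry`, no `axiom`, no `… : Prop` fact, no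
`instance`, no `notation`.  NEW file; nothing landed is modified.  Seat `lit-balaban-t2s-1` gen 4, 2026-08-28.
-/

noncomputable section

open scoped BigOperators

namespace Literature.MathematicalPhysics.QuantumFieldTheory.Balaban1983to89.B8Thm2TorusKnitEstimatesOfMajorants

open Node00 B6KLevelCensusIndexV1 B6Geom246MultiLevelBox B9BackgroundsKLevelV1 B9Eq39Adjoint B9Thm311ReadingCoords B9Thm311DeltaPrimePos
open B7Prop1Explicit renaming Site → LSite
open B7Prop1Explicit (e)
open B7Prop2Explicit (unitaryUnits AvgClosed C0 c2')
open B6RandomWalk (HasMajorant Triangle254 Ineq261)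
open B9Thm34Ext (toB6)
open B9GeoNormsKLevelV1 (geo9K)
open B9Eq352DivFormLetters (conj)
open B9Eq352GradLetters (diffLetter)
open B8Ineq132 (covDerivFwd InAk)
open B8Eq138LandauZd (covLap IsLandau138W)
open B8Eq1117Concrete (XSpace)
open B8Prop5ContractionKLevel (Bd2)
open B8LambdaSpaceKLevel (wt)
open B8Eq140Level (SideTouches)
open B8Eq184Proof (cfgExp)
open B8Lemma1NonAbelian (mulCfg)
open B8Eq146AExpansion (iEta plaqCovDeriv)
open B8Eq143PlaqExpansion (pdiv)
open B7Prop4GeneralLevels (linCovIter)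
open B8Eq155JBound (Jcur wsup)
open B8ScaledSupNorm (bondNorm msup)
open B9Eq340HolderZd (hquot AdmPair)
open B8Thm4TorusAt (torusLam)
open B8Thm2TorusMember (torusLamb)
open B8Thm2TorusLettersPer (LettersAtPer LettersAllPer LettersAllPerTau)
open B6GlobalChartV1 (PV boxEquiv)
open B9B8CarrierDictionary (liftCfg liftFun covDerivFwd_liftY covLap_liftY)
open B9B8AveragingJunction (parKnitY)
open B9Thm311PositivityKnitLetter (GpKnitY GpKnitY_apply)
open B9B8KnitLetterTransfer (siteAt descL descL_apply liftL liftL_eq liftL_apply descXL descXL_apply)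
open B8Thm2TorusLettersPerOfKnit (bgY bgY_mem KnitLettersY KnitEstimates knitGp knitHp knitQp knitQpT knitCinv knitGp_apply knitHp_eq shiftCfg_U₀
  liftCfg_bgY_mem knitR_eq_liftL)
open B8Thm2TorusLettersAllPerOfKnit (knitLettersY_familyOfInAk knitLettersY_familyOfInAk_G' knitLettersY_familyOfInAk_C' knitLettersY_familyOfInAk_H'
  parKnitY_mem_of_inAk inAk_univ_of_le)
open B9B8KnitLetterE12Sup (norm_GpKnitY_apply_le wt_norm_covDerivFwd_liftFun_le)
open B9B8KnitLetterHprimeBounds (knit_E6_constLev knit_E7_constLev')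
open B9B8KnitLetterHprimeLap (knit_E8_constLev)
open B9B8KnitLetterRBound (knit_E15_constLev)
open B9B8KnitLetterProjectionC (RY_parKnitY_smul)

variable {d ℓ : ℕ} {hd : 1 ≤ d + 1} {hL : Odd (ℓ + 1) ∧ 1 < ℓ + 1} {b₀ b₁ : ℝ}

/-! ## §1 Dictionary lemmas between the consumer's and def-Y's currencies -/

section Dictionary

variable {𝔸 : Type} [NormedRing 𝔸] [NormedAlgebra ℂ 𝔸] [CompleteSpace 𝔸]
variable (i : KIdx d ℓ hd hL b₀ b₁)

omit [CompleteSpace 𝔸] in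
/-- **`|f|₍₋₂₎ ≤ r` ON `T_η` AT LEVEL `n` READ AT THE BOX SITES**: `(Lⁿη)²‖f(w)‖ ≤ r` for every box site `w` (the junction's hypothesis shape).
[cite: Balaban1985RegularSpaces, p.86 (after (1.55)), (1.98) p.92, p.77 («Ω_j = T_η»)] -/
theorem bd2_descL {n : ℕ} {η : ℝ} {f : LSite (d + 1) → 𝔸} {r : ℝ}
    (hB : Bd2 (ℓ + 1) η n (fun _ => (Set.univ : Set (LSite (d + 1)))) f r) (w : SiteY i) :
    ((((ℓ + 1 : ℕ) : ℝ)) ^ n * η) ^ 2 * ‖descL i f w‖ ≤ r := by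
  rw [descL_apply]
  exact hB n le_rfl w.1 (Set.mem_univ _)

/-- the weights of `|·|₍₋₂₎` increase with the level: `(Lʲη)² ≤ (Lⁿη)²` for `j ≤ n`. [cite: Balaban1985RegularSpaces, p.86 (after (1.55)), bookkeeping] -/
theorem wt_sq_le_wt_sq (L : ℕ) (hL1 : 1 ≤ L) (η : ℝ) {j n : ℕ} (hj : j ≤ n) : wt L η j ^ 2 ≤ wt L η n ^ 2 := by
  unfold wt
  rw [mul_pow, mul_pow]
  have hL : (1 : ℝ) ≤ (L : ℝ) := by exact_mod_cast hL1
  exact mul_le_mul_of_nonneg_right (pow_le_pow_left₀ (by positivity) (pow_le_pow_right₀ hL hj) 2) (sq_nonneg η)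

/-- the weight at level `j`, with `η ≠ 0`: `(Lʲη)²·η⁻²·a = (Lʲ)²·a`. [cite: Balaban1985RegularSpaces, p.86, (1.1) p.76, bookkeeping] -/
theorem wt_sq_mul_inv_sq {η : ℝ} (hη : η ≠ 0) (j : ℕ) (a : ℝ) :
    wt (ℓ + 1) η j ^ 2 * (η⁻¹ * η⁻¹ * a) = ((((ℓ + 1 : ℕ) : ℝ)) ^ j) ^ 2 * a := by
  unfold wt
  field_simp

omit [CompleteSpace 𝔸] in
/-- the `XSpace` reading at level `n` is bounded by the `XSpace` norm: `‖X(n, y)‖ ≤ ‖X‖`. [cite: Balaban1985RegularSpaces, (1.92) p.91, p.95, bookkeeping] -/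
theorem norm_descXL_le (n : ℕ) (X : XSpace (d := d + 1) n 𝔸) (t : BlkY i) : ‖descXL i n X t‖ ≤ ‖X‖ := by
  rw [descXL_apply]
  exact X.norm_coe_le_norm _

/-- a row sum at the SMALLER rate dominates the row sum at the larger one. [cite: Balaban1984PropagatorsII, (2.61) p.234, bookkeeping] -/
theorem sum_exp_le_of_rate_le {S : Type} [Fintype S] {dist : S → S → ℝ} (hdnn : ∀ a a', 0 ≤ dist a a') {ρ δ c : ℝ} (hρδ : ρ ≤ δ)
    (hrow : ∀ a, ∑ a', Real.exp (-(ρ * dist a a')) ≤ c) (a : S) : ∑ a', Real.exp (-(δ * dist a a')) ≤ c :=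
  (Finset.sum_le_sum fun a' _ => Real.exp_le_exp.2 (neg_le_neg (mul_le_mul_of_nonneg_right hρδ (hdnn a a')))).trans (hrow a)

end Dictionary

section KnitR

open scoped Matrix Matrix.Norms.L2Operator

variable {N : ℕ} (i : KIdx d ℓ hd hL b₀ b₁)

/-- **`R` AT THE KNIT LETTER IN THE CONSUMER's UNITS**: `R(U; η²G′) Λ = Λ − η²G′ Q′* (Q′(η²G′)²Q′*)⁻¹ Q′ η²G′ Λ` (`rfl`).
[cite: Balaban1985RegularSpaces, (1.98) p.92; Balaban1985BackgroundPropagators, (3.49) p.399] -/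
theorem RY_knit_apply (η : ℝ) (U : CfgY (Matrix (Fin N) (Fin N) ℂ) i) (Λ : SiteY i → Matrix (Fin N) (Fin N) ℂ) :
    RY i (parKnitY i) ((((η * η : ℝ)) : ℂ) • GpY i (parKnitY i)) U Λ
      = Λ - GpKnitY i η U (QpsY i (parKnitY i) U
          (XinvY i (parKnitY i) ((((η * η : ℝ)) : ℂ) • GpY i (parKnitY i)) U (QpY i (parKnitY i) U (GpKnitY i η U Λ)))) := rfl

end KnitR

/-! ## §2 The displayed inputs: the (B)-line, the constants, the block majorants at one member -/

section Inputs

variable {𝔸 : Type} [CStarAlgebra 𝔸]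

/-- **THE (B)-LINE OF THE v3 LETTER BUNDLE AT ONE BACKGROUND** (`LettersAtPer.b9P3` ∕ `KnitEstimates.b9P3`, verbatim): Prop. 3's in-edge (1.59) in the frame of
truncation `m` — periodic `W`, `A′`; it involves no letter of [4]. [cite: Balaban1985RegularSpaces, (1.59) p.86, (1.33)–(1.34) p.82, Prop. 3 p.86] -/
def B9P3PerAt (L : ℕ) (B₀ B₀β cB β : ℝ) (len : LSite (d + 1) → ℝ) (η : ℝ) (m : ℕ) (α₀ : ℝ) (P : ℤ)
    (U₀ : LSite (d + 1) → Fin (d + 1) → 𝔸ˣ) : Prop :=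
  ∀ α₂ : ℝ, 0 < α₂ → α₂ ≤ cB →
    ∀ W : LSite (d + 1) → Fin (d + 1) → 𝔸ˣ, (∀ x κ, W x κ ∈ unitaryUnits 𝔸) → (∀ (z : LSite (d + 1)) (i : Fin (d + 1)), W (z + P • e i) = W z) →
    InAk L m η α₀ (fun _ => (Set.univ : Set (LSite (d + 1)))) U₀ →
    InAk L m η α₀ (fun _ => (Set.univ : Set (LSite (d + 1)))) (mulCfg W U₀) →
    IsLandau138W L m η (Set.univ : Set (LSite (d + 1))) (torusLam (d := d + 1) m) U₀ W →
    ∀ A' : LSite (d + 1) → Fin (d + 1) → 𝔸, (∀ y τ, IsSelfAdjoint (A' y τ)) → (∀ (z : LSite (d + 1)) (i : Fin (d + 1)), A' (z + P • e i) = A' z) →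
    (∀ j, j ≤ m → ∀ (y : LSite (d + 1)) (τ : Fin (d + 1)), SideTouches (Set.univ : Set (LSite (d + 1))) y τ →
      W y τ = cfgExp η A' y τ ∧ ‖A' y τ‖ ≤ α₂ * ((L : ℝ) ^ j * η)⁻¹) →
    (∀ (y : LSite (d + 1)) (τ : Fin (d + 1)), (∀ j, j ≤ m → ¬ SideTouches (Set.univ : Set (LSite (d + 1))) y τ) → A' y τ = 0) →
    msup L m η (-(1 : ℝ)) (fun _ (b : LSite (d + 1) × Fin (d + 1)) => SideTouches (Set.univ : Set (LSite (d + 1))) b.1 b.2) (fun b => A' b.1 b.2)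
        ≤ B₀ * (bondNorm L m η (-(3 : ℝ)) (fun _ => (Set.univ : Set (LSite (d + 1)))) (fun x μ => Jcur η U₀ A' μ x)
          + wsup 1 (fun p : {p : ℕ × (LSite (d + 1) × Fin (d + 1)) // p.1 ≤ m ∧ p.2 ∈ torusLamb (d := d + 1) m p.1} =>
              linCovIter L U₀ (iEta η A') p.1.1 p.1.2.1 p.1.2.2)) ∧
      msup L m η (-(2 : ℝ)) (fun _ (t : Fin (d + 1) × Fin (d + 1) × LSite (d + 1)) => SideTouches (Set.univ : Set (LSite (d + 1))) t.2.2 t.2.1)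
          (fun t => covDerivFwd η U₀ t.1 (fun z => A' z t.2.1) t.2.2)
        ≤ B₀ * (bondNorm L m η (-(3 : ℝ)) (fun _ => (Set.univ : Set (LSite (d + 1)))) (fun x μ => Jcur η U₀ A' μ x)
          + wsup 1 (fun p : {p : ℕ × (LSite (d + 1) × Fin (d + 1)) // p.1 ≤ m ∧ p.2 ∈ torusLamb (d := d + 1) m p.1} =>
              linCovIter L U₀ (iEta η A') p.1.1 p.1.2.1 p.1.2.2)) ∧
      bondNorm L m η (-(3 : ℝ)) (fun _ => (Set.univ : Set (LSite (d + 1)))) (fun x μ => pdiv η U₀ (plaqCovDeriv η U₀ A') μ x)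
        ≤ B₀ * (bondNorm L m η (-(3 : ℝ)) (fun _ => (Set.univ : Set (LSite (d + 1)))) (fun x μ => Jcur η U₀ A' μ x)
          + wsup 1 (fun p : {p : ℕ × (LSite (d + 1) × Fin (d + 1)) // p.1 ≤ m ∧ p.2 ∈ torusLamb (d := d + 1) m p.1} =>
              linCovIter L U₀ (iEta η A') p.1.1 p.1.2.1 p.1.2.2)) ∧
      bondNorm L m η (-(3 : ℝ)) (fun _ => (Set.univ : Set (LSite (d + 1)))) (fun x μ => covLap η U₀ (fun z => A' z μ) x)
        ≤ B₀ * (bondNorm L m η (-(3 : ℝ)) (fun _ => (Set.univ : Set (LSite (d + 1)))) (fun x μ => Jcur η U₀ A' μ x)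
          + wsup 1 (fun p : {p : ℕ × (LSite (d + 1) × Fin (d + 1)) // p.1 ≤ m ∧ p.2 ∈ torusLamb (d := d + 1) m p.1} =>
              linCovIter L U₀ (iEta η A') p.1.1 p.1.2.1 p.1.2.2)) ∧
      msup L m η (-(2 + β)) (fun _ (q : Fin (d + 1) × Fin (d + 1) × (LSite (d + 1) × LSite (d + 1))) =>
            q.2.2 ∈ AdmPair η len ∧ q.2.2.1 ∈ (Set.univ : Set (LSite (d + 1))))
          (fun q => hquot η β len U₀ (covDerivFwd η U₀ q.1 (fun z => A' z q.2.1)) q.2.2)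
        ≤ B₀β * (bondNorm L m η (-(3 : ℝ)) (fun _ => (Set.univ : Set (LSite (d + 1)))) (fun x μ => Jcur η U₀ A' μ x)
          + wsup 1 (fun p : {p : ℕ × (LSite (d + 1) × Fin (d + 1)) // p.1 ≤ m ∧ p.2 ∈ torusLamb (d := d + 1) m p.1} =>
              linCovIter L U₀ (iEta η A') p.1.1 p.1.2.1 p.1.2.2))

end Inputs

section MajorantInputs

open scoped Matrix Matrix.Norms.L2Operator

variable {N : ℕ}

/-- **THE UNIFORM CONSTANTS OF THE MAJORANT PACKAGE** (member- and background-free): a real basis `b` of `M_N(ℂ)` with coordinate constant `M₂` ([B9] p. 391 real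
coordinates), the amplitudes `A` ((3.42)₁), `A₁` ((3.42)₂), `K` ((3.48)), the rate budget `ρ + 2βₓδ₀ ≤ δ` of the walk resummation ([4] (2.61)–(2.63)).
[cite: Balaban1985BackgroundPropagators, Thm 3.1 (3.42) p.397, Thm 3.2 (3.48) p.398, p.391; Balaban1984PropagatorsII, (2.61)–(2.63) p.234] -/
structure KnitConstants {ι : Type} [Fintype ι] (b : Module.Basis ι ℝ (Matrix (Fin N) (Fin N) ℂ)) (M₂ δ₀ δ βx ρ A A₁ K : ℝ) : Prop where
  /-- `M₂ ≥ 0`. -/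
  hM₂ : 0 ≤ M₂
  /-- the real coordinates are `M₂`-bounded. -/
  hrepr : ∀ (v : Matrix (Fin N) (Fin N) ℂ) (j : ι), |b.repr v j| ≤ M₂ * ‖v‖
  /-- `A ≥ 0`. -/
  hA : 0 ≤ A
  /-- `A₁ ≥ 0`. -/
  hA₁ : 0 ≤ A₁
  /-- `K ≥ 0`. -/
  hK : 0 ≤ K
  /-- `ρ ≥ 0`. -/
  hρ : 0 ≤ ρ
  /-- `βₓ ≥ 0`. -/
  hβ : 0 ≤ βx
  /-- `δ₀ ≥ 0`. -/
  hδ₀ : 0 ≤ δ₀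
  /-- the rate budget. -/
  hr : ρ + 2 * (βx * δ₀) ≤ δ

/-- the final rate is below the majorants' rate: `ρ ≤ δ`. [cite: Balaban1984PropagatorsII, (2.61)–(2.63) p.234, bookkeeping] -/
theorem KnitConstants.rho_le_delta {ι : Type} [Fintype ι] {b : Module.Basis ι ℝ (Matrix (Fin N) (Fin N) ℂ)} {M₂ δ₀ δ βx ρ A A₁ K : ℝ}
    (cst : KnitConstants b M₂ δ₀ δ βx ρ A A₁ K) : ρ ≤ δ := by
  have h := cst.hr
  nlinarith [mul_nonneg cst.hβ cst.hδ₀]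

/-- the weaker budget `ρ + βₓδ₀ ≤ δ` of (E15). [cite: Balaban1984PropagatorsII, (2.61)–(2.63) p.234, bookkeeping] -/
theorem KnitConstants.hr₁ {ι : Type} [Fintype ι] {b : Module.Basis ι ℝ (Matrix (Fin N) (Fin N) ℂ)} {M₂ δ₀ δ βx ρ A A₁ K : ℝ}
    (cst : KnitConstants b M₂ δ₀ δ βx ρ A A₁ K) : ρ + βx * δ₀ ≤ δ := by
  have h := cst.hr
  nlinarith [mul_nonneg cst.hβ cst.hδ₀]

variable (i : KIdx d ℓ hd hL b₀ b₁) [Fintype (geo9K i).Site]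

/-- **THE DISPLAYED MAJORANT PACKAGE AT ONE MEMBER AND ONE BACKGROUND** — the output shapes of M5.5 ((3.42)₁ `hGm`, (3.42)₂ `hDG`) and M5.6 ((3.48) `hC`) at print's
transporters `parKnitY` (junction files 9 ∕ 10 ∕ 15 ∕ 16 ∕ 20), with the member's block index section `ιB`, its scale `c_f = Lᵏ`, the unit `s = η_S⁻⁴`, the [4]
§2 geometry of its block set (`Triangle254`, `Ineq261`, distances `≥ 0`) and the row sum (2.61) at the final rate `ρ`.
[cite: Balaban1985BackgroundPropagators, Thm 3.1 (3.42) p.397, Thm 3.2 (3.48) p.398, (3.19) p.393, (3.3) p.390; Balaban1984PropagatorsII, (2.51)–(2.54) p.232, (2.61) p.234] -/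
structure KnitMajorants (U : CfgY (Matrix (Fin N) (Fin N) ℂ) i) {ι : Type} [Fintype ι] (b : Module.Basis ι ℝ (Matrix (Fin N) (Fin N) ℂ))
    (ιB : BlkY i → IBondY i) (Rr : ℝ) (Hp : Prop) (d₁ : ℕ) (δ₀ δ βx ρ A A₁ K c s : ℝ) : Prop where
  /-- `ιB` is a section of the carrier-block map `β`. -/
  hι : ∀ t, B6Ineq2142KLevelV1.β i.hN i.D i.hk (ιB t) = t
  /-- the member's scale is `c_f = Lᵏ`. -/
  hcf : i.cf = (((ℓ + 1 : ℕ) : ℝ)) ^ i.k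
  /-- the unit of `C`: `η_S⁴·s = 1`. -/
  hs : (etaS i ^ 2 * etaS i ^ 2) * s = 1
  /-- distances are non-negative. -/
  hdnn : ∀ a a' : (geo9K i).Site, 0 ≤ (geo9K i).dist a a'
  /-- [4] (2.54). -/
  htri : Triangle254 (toB6 (geo9K i) Rr Hp)
  /-- [4] (2.61)-type summability. -/
  h261 : Ineq261 d₁ (toB6 (geo9K i) Rr Hp) δ₀ βx
  /-- the row sum at the final rate. -/
  hrow : ∀ a : (geo9K i).Site, ∑ a' : (geo9K i).Site, Real.exp (-(ρ * (geo9K i).dist a a')) ≤ c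
  /-- (3.42)₁ for `η_S²G′(U; parKnitY)` (M5.5 at print's transporters). -/
  hGm : HasMajorant (g := toB6 (geo9K i) Rr Hp) (fun p : SiteY i × ι => ιB (blkOf i.D.toDomains p.1))
      (conj b ((etaS i ^ 2) • (GpY i (parKnitY i) U).restrictScalars ℝ))
      (fun a a' => A * (geo9K i).len a ^ 2 * Real.exp (-(δ * (geo9K i).dist a a')))
  /-- (3.42)₂ for `η_S⁻¹∇_μ · η_S²G′(U; parKnitY)`, every direction. -/
  hDG : ∀ μ : Fin (d + 1), HasMajorant (g := toB6 (geo9K i) Rr Hp) (fun p : SiteY i × ι => ιB (blkOf i.D.toDomains p.1))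
      (conj b (diffLetter (shiftY i) (UboxY i U) ((((etaS i : ℝ) : ℂ))⁻¹) (Sum.inl μ)) * conj b ((etaS i ^ 2) • (GpY i (parKnitY i) U).restrictScalars ℝ))
      (fun a a' => A₁ * (geo9K i).len a * Real.exp (-(δ * (geo9K i).dist a a')))
  /-- (3.48) for `s·(Q′G′²Q′*)⁻¹(U; parKnitY)` (M5.6 at print's transporters). -/
  hC : HasMajorant (g := toB6 (geo9K i) Rr Hp) (fun q : BlkY i × ι => ιB q.1)
      (conj b (s • (XinvY i (parKnitY i) (GpY i (parKnitY i)) U).restrictScalars ℝ))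
      (fun a a' => K * ((geo9K i).len a ^ 4)⁻¹ * Real.exp (-(δ * (geo9K i).dist a a')))

/-- the row sum at the majorants' rate `δ ≥ ρ`. [cite: Balaban1984PropagatorsII, (2.61) p.234, bookkeeping] -/
theorem KnitMajorants.hrow_delta {U : CfgY (Matrix (Fin N) (Fin N) ℂ) i} {ι : Type} [Fintype ι] {b : Module.Basis ι ℝ (Matrix (Fin N) (Fin N) ℂ)}
    {ιB : BlkY i → IBondY i} {Rr : ℝ} {Hp : Prop} {d₁ : ℕ} {δ₀ δ βx ρ A A₁ K c s : ℝ}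
    (maj : KnitMajorants i U b ιB Rr Hp d₁ δ₀ δ βx ρ A A₁ K c s) (hρδ : ρ ≤ δ) :
    ∀ a : (geo9K i).Site, ∑ a' : (geo9K i).Site, Real.exp (-(δ * (geo9K i).dist a a')) ≤ c :=
  sum_exp_le_of_rate_le maj.hdnn hρδ maj.hrow

end MajorantInputs

/-! ## §3 ★★★ `KnitEstimates` at one background from the displayed majorants -/

section OneBackground

open scoped Matrix Matrix.Norms.L2Operator

variable {N : ℕ} [NeZero N] {G : Subgroup (Matrix (Fin N) (Fin N) ℂ)ˣ}

/-- ★★★ **THE ESTIMATE BUNDLE OF THE v3 LETTERS AT ONE BACKGROUND, READ OFF THE JUNCTION's BLOCK MAJORANTS.**  Members `mem n` of constant level `n` on the torus of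
side `P` (`1 ≤ n ≤ m`), `G ≤ U(N)` averaging-closed, a `G`-valued `P`-periodic `U₀ ∈ 𝔄_m(T_η, α₀)` with `C₀α₀ ≤ 1∕3`, `2α₀ ≤ c₂′`, `η > 0`; uniform constants
`KnitConstants b M₂ δ₀ δ βₓ ρ A A₁ K`; at every member `n ≤ m` the majorant package `KnitMajorants` at the background read on member `n`'s box; thresholds
`(Σ‖b‖)·A·c·M₂ ≤ B_G`, `(Σ‖b‖)·A₁·c·M₂ ≤ B_G` ((E12)), `(Σ‖b‖)·((M₂Σ‖b‖)·A·A·K·c₁²)·c·M₂ ≤ B₀′ᴴ`, the same with `A₁·A` ((E6)∕(E7)),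
`(Σ‖b‖)·((M₂Σ‖b‖)·A·K·c₁)·c·M₂ + (Σ‖b‖)·((M₂Σ‖b‖)·A·A·K·c₁²)·c·M₂ ≤ B₂′` ((E8)), `1 + (Σ‖b‖)·((M₂Σ‖b‖)²·A·K·A·c₁²)·c·M₂ ≤ B_R` ((E15)); and the (B)-line.
Conclusion: `KnitEstimates mem η U₀ (knitLettersY_familyOfInAk …) (ℓ+1) B_G B_R B₀′ᴴ B₂′ B₀ B₀β c_B β len α₀ P`.  No estimate of [B8]∕[4] proved: the majorants
and the (B)-line are displayed; the Yang–Mills mass gap is NOT proved.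
[cite: Balaban1985RegularSpaces, (1.91)–(1.92) p.91, (1.98) p.92, (1.101) p.93, p.86, (1.59) p.86, p.77 («Ω_j = T_η»); Balaban1985BackgroundPropagators, Thm 3.1 (3.42) p.397, (3.47) p.398, Thm 3.2 (3.48) p.398, (3.49) p.399, (3.19)–(3.25) pp.393–395; Balaban1984PropagatorsII, (2.51)–(2.52) p.232, (2.61) p.234] -/
theorem knitEstimates_of_majorants (mem : ℕ → KIdx d ℓ hd hL b₀ b₁) [∀ n, Fintype (geo9K (mem n)).Site] [∀ n, DecidableEq (geo9K (mem n)).Site]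
    {m : ℕ} {P : ℤ} (hP : ∀ n, 1 ≤ n → n ≤ m → (((PV d ℓ (mem n).m (mem n).K hd hL).sitesPerDir 0 : ℕ) : ℤ) = P)
    (hlev : ∀ n, 1 ≤ n → n ≤ m → ∀ z : SiteY (mem n), levY (mem n) z = n)
    (hG : G ≤ unitaryUnits (Matrix (Fin N) (Fin N) ℂ)) (hGa : AvgClosed (d + 1) (ℓ + 1) G)
    {U₀ : LSite (d + 1) → Fin (d + 1) → (Matrix (Fin N) (Fin N) ℂ)ˣ} (hU₀G : ∀ x μ, U₀ x μ ∈ G)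
    (hU₀per : ∀ (x : LSite (d + 1)) (μ : Fin (d + 1)), U₀ (x + P • e μ) = U₀ x)
    {η α₀ : ℝ} (hη : 0 < η) (hα : 0 < α₀) (hα3 : C0 (d + 1) * α₀ ≤ 1 / 3) (hα2 : 2 * α₀ ≤ c2' (d + 1) (ℓ + 1))
    (hA : InAk (ℓ + 1) m η α₀ (fun _ => (Set.univ : Set (LSite (d + 1)))) U₀)
    {ι : Type} [Fintype ι] {b : Module.Basis ι ℝ (Matrix (Fin N) (Fin N) ℂ)} {M₂ δ₀ δ βx ρ A A₁ K c : ℝ} {d₁ : ℕ}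
    (cst : KnitConstants b M₂ δ₀ δ βx ρ A A₁ K)
    {ιB : ∀ n, BlkY (mem n) → IBondY (mem n)} {Rr : ℝ} {Hp : Prop} {s : ℕ → ℝ}
    (maj : ∀ n, 1 ≤ n → n ≤ m → KnitMajorants (mem n) (bgY (mem n) U₀) b (ιB n) Rr Hp d₁ δ₀ δ βx ρ A A₁ K c (s n))
    {BG BR B₀'H B₂' B₀ B₀β cB β : ℝ} {len : LSite (d + 1) → ℝ}
    (hBG : (∑ j, ‖b j‖) * A * c * M₂ ≤ BG) (hBG₁ : (∑ j, ‖b j‖) * A₁ * c * M₂ ≤ BG)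
    (hBH : (∑ j, ‖b j‖) * (((M₂ * ∑ j, ‖b j‖) * A * A * K * B6.c1 d₁ δ₀ βx ^ 2) * c * M₂) ≤ B₀'H)
    (hBH₁ : (∑ j, ‖b j‖) * (((M₂ * ∑ j, ‖b j‖) * A₁ * A * K * B6.c1 d₁ δ₀ βx ^ 2) * c * M₂) ≤ B₀'H)
    (hB₂ : (∑ j, ‖b j‖) * (((M₂ * ∑ j, ‖b j‖) * A * K * B6.c1 d₁ δ₀ βx) * c * M₂)
        + (∑ j, ‖b j‖) * (((M₂ * ∑ j, ‖b j‖) * A * A * K * B6.c1 d₁ δ₀ βx ^ 2) * c * M₂) ≤ B₂')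
    (hBR : 1 + (∑ j, ‖b j‖) * (((M₂ * ∑ j, ‖b j‖) ^ 2 * A * K * A * B6.c1 d₁ δ₀ βx ^ 2) * c * M₂) ≤ BR)
    (hb9 : letI : CStarAlgebra (Matrix (Fin N) (Fin N) ℂ) := {}
      B9P3PerAt (𝔸 := Matrix (Fin N) (Fin N) ℂ) (ℓ + 1) B₀ B₀β cB β len η m α₀ P U₀) :
    letI : CStarAlgebra (Matrix (Fin N) (Fin N) ℂ) := {}
    KnitEstimates (𝔸 := Matrix (Fin N) (Fin N) ℂ) mem η U₀ (knitLettersY_familyOfInAk mem hP hlev hG hGa hU₀G hU₀per hη.ne' hα hα3 hα2 hA)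
      (ℓ + 1) BG BR B₀'H B₂' B₀ B₀β cB β len α₀ P := by
  letI : CStarAlgebra (Matrix (Fin N) (Fin N) ℂ) := {}
  haveI : Nonempty (Fin N) := ⟨⟨0, Nat.pos_of_ne_zero (NeZero.ne N)⟩⟩
  have hL1 : 1 ≤ ℓ + 1 := Nat.succ_le_succ (Nat.zero_le ℓ)
  have hη0 : η ≠ 0 := hη.ne'
  have hc : ((((η * η : ℝ)) : ℂ)) ≠ 0 := Complex.ofReal_ne_zero.mpr (mul_ne_zero hη0 hη0)
  -- the knit legs are `G`-valued at every member (file A3)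
  have hpar : ∀ n (hn : 1 ≤ n) (hnm : n ≤ m), ∀ z w : SiteY (mem n), parKnitY (mem n) (bgY (mem n) U₀) z w ∈ G := fun n hn hnm =>
    parKnitY_mem_of_inAk (mem n) (hlev n hn hnm) hn hGa hU₀G (shiftCfg_U₀ mem U₀ hP hU₀per hn hnm) hα hα3 hα2 (inAk_univ_of_le hnm hA)
  have hρδ : ρ ≤ δ := cst.rho_le_delta
  exact
  { hp_sup := fun n hn hnm X _ x => by
      have hY : ∀ t, ‖descXL (mem n) n X t‖ ≤ ‖X‖ := norm_descXL_le (mem n) n X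
      have key := knit_E6_constLev (mem n) b (ιB n) (hlev n hn hnm) hG (hpar n hn hnm) cst.hM₂ cst.hrepr d₁ cst.hA cst.hK cst.hρ cst.hβ cst.hδ₀
        cst.hr (maj n hn hnm).hs (maj n hn hnm).hdnn (maj n hn hnm).htri (maj n hn hnm).h261 (maj n hn hnm).hGm (maj n hn hnm).hC (maj n hn hnm).hrow
        (descXL (mem n) n X) hY (siteAt (mem n) x)
      rw [knitHp_eq mem η U₀ _ hn hnm, liftL_apply, knitLettersY_familyOfInAk_H']
      simp only [LinearMap.comp_apply]
      refine key.trans ?_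
      calc (∑ j, ‖b j‖) * (((M₂ * ∑ j, ‖b j‖) * A * A * K * B6.c1 d₁ δ₀ βx ^ 2) * c * (M₂ * ‖X‖))
          = ((∑ j, ‖b j‖) * (((M₂ * ∑ j, ‖b j‖) * A * A * K * B6.c1 d₁ δ₀ βx ^ 2) * c * M₂)) * ‖X‖ := by ring
        _ ≤ B₀'H * ‖X‖ := mul_le_mul_of_nonneg_right hBH (norm_nonneg _)
    hp_grad := fun n hn hnm j hj X _ p _ => by
      have hY : ∀ t, ‖descXL (mem n) n X t‖ ≤ ‖X‖ := norm_descXL_le (mem n) n X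
      have key := knit_E7_constLev' (mem n) b (ιB n) (hlev n hn hnm) (maj n hn hnm).hcf hG (hpar n hn hnm) cst.hM₂ cst.hrepr d₁ cst.hA₁ cst.hA
        cst.hK cst.hρ cst.hβ cst.hδ₀ cst.hr (maj n hn hnm).hs (maj n hn hnm).hdnn (maj n hn hnm).htri (maj n hn hnm).h261 p.2 ((maj n hn hnm).hDG p.2)
        (maj n hn hnm).hGm (maj n hn hnm).hC (maj n hn hnm).hrow hη (descXL (mem n) n X) hY hj (siteAt (mem n) p.1)
      have hcd := covDerivFwd_liftY (mem n) η (bgY (mem n) U₀) p.2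
        ((knitLettersY_familyOfInAk mem hP hlev hG hGa hU₀G hU₀per hη.ne' hα hα3 hα2 hA n hn hnm).H' (descXL (mem n) n X)) p.1
      rw [liftCfg_bgY_mem mem U₀ hP hU₀per hn hnm, ← liftL_eq, ← knitHp_eq mem η U₀ _ hn hnm] at hcd
      rw [hcd, norm_smul, Real.norm_of_nonneg (inv_nonneg.2 hη.le), knitLettersY_familyOfInAk_H']
      simp only [LinearMap.comp_apply]
      refine key.trans ?_
      calc (∑ j, ‖b j‖) * (((M₂ * ∑ j, ‖b j‖) * A₁ * A * K * B6.c1 d₁ δ₀ βx ^ 2) * c * (M₂ * ‖X‖))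
          = ((∑ j, ‖b j‖) * (((M₂ * ∑ j, ‖b j‖) * A₁ * A * K * B6.c1 d₁ δ₀ βx ^ 2) * c * M₂)) * ‖X‖ := by ring
        _ ≤ B₀'H * ‖X‖ := mul_le_mul_of_nonneg_right hBH₁ (norm_nonneg _)
    hp_lap := fun n hn hnm X _ j hj x _ => by
      have hY : ∀ t, ‖descXL (mem n) n X t‖ ≤ ‖X‖ := norm_descXL_le (mem n) n X
      have key := knit_E8_constLev (mem n) b (ιB n) (hlev n hn hnm) (maj n hn hnm).hcf hG (bgY_mem (mem n) hU₀G) (hpar n hn hnm) cst.hM₂ cst.hrepr d₁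
        cst.hA cst.hK cst.hρ cst.hβ cst.hδ₀ cst.hr (maj n hn hnm).hs (maj n hn hnm).hdnn (maj n hn hnm).htri (maj n hn hnm).h261 (maj n hn hnm).hGm
        (maj n hn hnm).hC (maj n hn hnm).hrow (descXL (mem n) n X) hY hj (siteAt (mem n) x)
      have hcl := covLap_liftY (mem n) η (bgY (mem n) U₀)
        ((knitLettersY_familyOfInAk mem hP hlev hG hGa hU₀G hU₀per hη.ne' hα hα3 hα2 hA n hn hnm).H' (descXL (mem n) n X)) x
      rw [liftCfg_bgY_mem mem U₀ hP hU₀per hn hnm, ← liftL_eq, ← knitHp_eq mem η U₀ _ hn hnm] at hcl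
      rw [hcl, norm_smul, Real.norm_of_nonneg (mul_self_nonneg η⁻¹), wt_sq_mul_inv_sq hη0, knitLettersY_familyOfInAk_H']
      simp only [LinearMap.comp_apply]
      refine key.trans ?_
      calc (∑ j, ‖b j‖) * (((M₂ * ∑ j, ‖b j‖) * A * K * B6.c1 d₁ δ₀ βx) * c * (M₂ * ‖X‖))
            + (∑ j, ‖b j‖) * (((M₂ * ∑ j, ‖b j‖) * A * A * K * B6.c1 d₁ δ₀ βx ^ 2) * c * (M₂ * ‖X‖))
          = ((∑ j, ‖b j‖) * (((M₂ * ∑ j, ‖b j‖) * A * K * B6.c1 d₁ δ₀ βx) * c * M₂)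
              + (∑ j, ‖b j‖) * (((M₂ * ∑ j, ‖b j‖) * A * A * K * B6.c1 d₁ δ₀ βx ^ 2) * c * M₂)) * ‖X‖ := by ring
        _ ≤ B₂' * ‖X‖ := mul_le_mul_of_nonneg_right hB₂ (norm_nonneg _)
    gp_sup_grad := fun n hn hnm f _ r hr0 hB => by
      have hΛ : ∀ w : SiteY (mem n), ((((ℓ + 1 : ℕ) : ℝ)) ^ n * η) ^ 2 * ‖descL (mem n) f w‖ ≤ r := bd2_descL (mem n) hB
      refine ⟨fun x => ?_, fun j hj p _ => ?_⟩
      · rw [knitGp_apply mem η U₀ _ hn hnm, liftL_apply, knitLettersY_familyOfInAk_G']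
        exact (norm_GpKnitY_apply_le (mem n) b (ιB n) (maj n hn hnm).hι (hlev n hn hnm) (maj n hn hnm).hcf (bgY (mem n) U₀) cst.hA (maj n hn hnm).hGm
          ((maj n hn hnm).hrow_delta (mem n) hρδ) cst.hM₂ cst.hrepr hη0 (descL (mem n) f) hΛ (siteAt (mem n) x)).trans
          (mul_le_mul_of_nonneg_right hBG hr0)
      · have h := wt_norm_covDerivFwd_liftFun_le (mem n) b (ιB n) (maj n hn hnm).hι (hlev n hn hnm) (maj n hn hnm).hcf (bgY (mem n) U₀) p.2 cst.hA₁
          ((maj n hn hnm).hDG p.2) ((maj n hn hnm).hrow_delta (mem n) hρδ) cst.hM₂ cst.hrepr hη (descL (mem n) f) hΛ hj p.1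
        rw [liftCfg_bgY_mem mem U₀ hP hU₀per hn hnm, ← liftL_eq] at h
        rw [knitGp_apply mem η U₀ _ hn hnm, knitLettersY_familyOfInAk_G']
        exact h.trans (mul_le_mul_of_nonneg_right hBG₁ hr0)
    r_bound := fun n hn hnm f hf r hr0 hB j hj x _ => by
      have hΛ : ∀ w : SiteY (mem n), ((((ℓ + 1 : ℕ) : ℝ)) ^ n * η) ^ 2 * ‖descL (mem n) f w‖ ≤ r := bd2_descL (mem n) hB
      have key := knit_E15_constLev (mem n) b (ιB n) (hlev n hn hnm) hG (hpar n hn hnm) cst.hM₂ cst.hrepr d₁ cst.hA cst.hK cst.hρ cst.hβ cst.hδ₀ cst.hr₁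
        (maj n hn hnm).hs (maj n hn hnm).hdnn (maj n hn hnm).htri (maj n hn hnm).h261 (maj n hn hnm).hGm (maj n hn hnm).hC (maj n hn hnm).hrow hη0
        (descL (mem n) f) hΛ (siteAt (mem n) x)
      rw [← RY_parKnitY_smul (mem n) (bgY (mem n) U₀) hc] at key
      rw [knitR_eq_liftL mem η U₀ _ hP hlev hU₀per hn hnm hf, liftL_apply, knitLettersY_familyOfInAk_G', knitLettersY_familyOfInAk_C',
        ← RY_knit_apply]
      exact (mul_le_mul_of_nonneg_right (wt_sq_le_wt_sq (ℓ + 1) hL1 η hj) (norm_nonneg _)).trans (key.trans (mul_le_mul_of_nonneg_right hBR hr0))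
    b9P3 := hb9 }

end OneBackground

/-! ## §4 ★★★★ The binder and [B8] Thm 2 on `T_η` from the displayed majorants -/

section Binder

open scoped Matrix Matrix.Norms.L2Operator
open B8Thm2TorusLettersAllPerOfKnit (knitLettersY_familyAt lettersAllPer_ofParKnitY lettersAllPerTau_ofParKnitY threshold3_of_le threshold2_of_le)
open B8Thm2TorusLettersPerOfKnit (KnitLettersYTau)
open B7Prop2SpecialUnitary (specialUnitaryUnits specialUnitaryUnits_le_unitaryUnits)
open B7AvgClosedSpecialUnitarySharp (avgClosed_specialUnitary_of_le)
open B8SpecialUnitaryTrace (trCLM)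
open B8Thm2TorusAt (Thm2TorusAt)
open B8Thm2TorusAtOfLettersPerB9 (thm2TorusAt_specialUnitary_of_lettersPerB9)

variable {N : ℕ} [NeZero N] {G : Subgroup (Matrix (Fin N) (Fin N) ℂ)ˣ}

/-- ★★★ **THE ESTIMATE BUNDLES OF THE BINDER's FAMILY** (file A3's `knitLettersY_familyAt`, every truncation `m ≤ k`, regularity `α₀ ≤ c_L`, background of the
class) from the majorant packages displayed PER MEMBER AND BACKGROUND (member `n` reads every `G`-valued `P`-periodic `U₀ ∈ 𝔄_n(T_η, α₀)`, `α₀ ≤ c_L`), the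
uniform constants, the four thresholds and the (B)-lines.
[cite: Balaban1985RegularSpaces, (1.91)–(1.92) p.91, (1.98) p.92, (1.101) p.93, (1.59) p.86, (1.7) p.77; Balaban1985BackgroundPropagators, Thm 3.1 (3.42) p.397, Thm 3.2 (3.48) p.398] -/
theorem knitEstimates_familyAt_of_majorants (mem : ℕ → KIdx d ℓ hd hL b₀ b₁) [∀ n, Fintype (geo9K (mem n)).Site]
    [∀ n, DecidableEq (geo9K (mem n)).Site] {k : ℕ} {P : ℤ}
    (hP : ∀ n, 1 ≤ n → n ≤ k → (((PV d ℓ (mem n).m (mem n).K hd hL).sitesPerDir 0 : ℕ) : ℤ) = P)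
    (hlev : ∀ n, 1 ≤ n → n ≤ k → ∀ z : SiteY (mem n), levY (mem n) z = n)
    (hG : G ≤ unitaryUnits (Matrix (Fin N) (Fin N) ℂ)) (hGa : AvgClosed (d + 1) (ℓ + 1) G)
    {η : ℝ} (hη : 0 < η) {cL : ℝ} (hc3 : C0 (d + 1) * cL ≤ 1 / 3) (hc2 : 2 * cL ≤ c2' (d + 1) (ℓ + 1))
    {ι : Type} [Fintype ι] {b : Module.Basis ι ℝ (Matrix (Fin N) (Fin N) ℂ)} {M₂ δ₀ δ βx ρ A A₁ K c : ℝ} {d₁ : ℕ}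
    (cst : KnitConstants b M₂ δ₀ δ βx ρ A A₁ K)
    {ιB : ∀ n, BlkY (mem n) → IBondY (mem n)} {Rr : ℝ} {Hp : Prop} {s : ℕ → ℝ}
    (maj : ∀ n, 1 ≤ n → n ≤ k → ∀ ⦃α₀ : ℝ⦄, 0 < α₀ → α₀ ≤ cL → ∀ U₀ : LSite (d + 1) → Fin (d + 1) → (Matrix (Fin N) (Fin N) ℂ)ˣ,
      (∀ x κ, U₀ x κ ∈ G) → (∀ (x : LSite (d + 1)) (μ : Fin (d + 1)), U₀ (x + P • e μ) = U₀ x) →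
      InAk (ℓ + 1) n η α₀ (fun _ => (Set.univ : Set (LSite (d + 1)))) U₀ →
      KnitMajorants (mem n) (bgY (mem n) U₀) b (ιB n) Rr Hp d₁ δ₀ δ βx ρ A A₁ K c (s n))
    {BG BR B₀'H B₂' B₀ B₀β cB β : ℝ} {len : LSite (d + 1) → ℝ}
    (hBG : (∑ j, ‖b j‖) * A * c * M₂ ≤ BG) (hBG₁ : (∑ j, ‖b j‖) * A₁ * c * M₂ ≤ BG)
    (hBH : (∑ j, ‖b j‖) * (((M₂ * ∑ j, ‖b j‖) * A * A * K * B6.c1 d₁ δ₀ βx ^ 2) * c * M₂) ≤ B₀'H)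
    (hBH₁ : (∑ j, ‖b j‖) * (((M₂ * ∑ j, ‖b j‖) * A₁ * A * K * B6.c1 d₁ δ₀ βx ^ 2) * c * M₂) ≤ B₀'H)
    (hB₂ : (∑ j, ‖b j‖) * (((M₂ * ∑ j, ‖b j‖) * A * K * B6.c1 d₁ δ₀ βx) * c * M₂)
        + (∑ j, ‖b j‖) * (((M₂ * ∑ j, ‖b j‖) * A * A * K * B6.c1 d₁ δ₀ βx ^ 2) * c * M₂) ≤ B₂')
    (hBR : 1 + (∑ j, ‖b j‖) * (((M₂ * ∑ j, ‖b j‖) ^ 2 * A * K * A * B6.c1 d₁ δ₀ βx ^ 2) * c * M₂) ≤ BR)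
    (hb9 : letI : CStarAlgebra (Matrix (Fin N) (Fin N) ℂ) := {}
      ∀ m, m ≤ k → ∀ ⦃α₀ : ℝ⦄, 0 < α₀ → α₀ ≤ cL → ∀ U₀ : LSite (d + 1) → Fin (d + 1) → (Matrix (Fin N) (Fin N) ℂ)ˣ,
        (∀ x κ, U₀ x κ ∈ G) → (∀ (x : LSite (d + 1)) (μ : Fin (d + 1)), U₀ (x + P • e μ) = U₀ x) →
        InAk (ℓ + 1) m η α₀ (fun _ => (Set.univ : Set (LSite (d + 1)))) U₀ →
        B9P3PerAt (𝔸 := Matrix (Fin N) (Fin N) ℂ) (ℓ + 1) B₀ B₀β cB β len η m α₀ P U₀) :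
    letI : CStarAlgebra (Matrix (Fin N) (Fin N) ℂ) := {}
    ∀ (m : ℕ) (hm : m ≤ k) (α₀ : ℝ) (hα : 0 < α₀) (hc : α₀ ≤ cL) (U₀ : LSite (d + 1) → Fin (d + 1) → (Matrix (Fin N) (Fin N) ℂ)ˣ)
      (hU₀G : ∀ x κ, U₀ x κ ∈ G) (hU₀per : ∀ (x : LSite (d + 1)) (μ : Fin (d + 1)), U₀ (x + P • e μ) = U₀ x)
      (hA : InAk (ℓ + 1) m η α₀ (fun _ => (Set.univ : Set (LSite (d + 1)))) U₀),
      KnitEstimates (𝔸 := Matrix (Fin N) (Fin N) ℂ) mem η U₀ (knitLettersY_familyAt mem hP hlev hG hGa hη.ne' hc3 hc2 hm hα hc hU₀G hU₀per hA)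
        (ℓ + 1) BG BR B₀'H B₂' B₀ B₀β cB β len α₀ P := by
  letI : CStarAlgebra (Matrix (Fin N) (Fin N) ℂ) := {}
  intro m hm α₀ hα hc U₀ hU₀G hU₀per hA
  exact knitEstimates_of_majorants mem (fun n hn hnm => hP n hn (hnm.trans hm)) (fun n hn hnm => hlev n hn (hnm.trans hm)) hG hGa hU₀G hU₀per hη hα
    (threshold3_of_le hc hc3) (threshold2_of_le hc hc2) hA cst
    (fun n hn hnm => maj n hn (hnm.trans hm) hα hc U₀ hU₀G hU₀per (inAk_univ_of_le hnm hA)) hBG hBG₁ hBH hBH₁ hB₂ hBR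
    (hb9 m hm hα hc U₀ hU₀G hU₀per hA)

/-- ★★★★ **THE BINDER `LettersAllPer (ℓ+1) … c_L η k P G` OF THE G-B8-T2S ENDPOINT FROM THE DISPLAYED MAJORANT PACKAGES AND (B)-LINES ALONE** (files A2–A4
composed): its letters are [4]'s operators at print's transporters; what is displayed is named in M5.5∕M5.6∕M5.7–8's own output shapes.  No estimate proved; the
Yang–Mills mass gap is NOT proved.
[cite: Balaban1985RegularSpaces, Thm 2 p.83, (1.91)–(1.98) pp.91–92, (1.101) p.93, (1.59) p.86, (1.7) p.77; Balaban1985BackgroundPropagators, Thm 3.1 (3.42) p.397, Thm 3.2 (3.48) p.398, (3.19)–(3.25) pp.393–395] -/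
def lettersAllPer_ofMajorants (mem : ℕ → KIdx d ℓ hd hL b₀ b₁) [∀ n, Fintype (geo9K (mem n)).Site]
    [∀ n, DecidableEq (geo9K (mem n)).Site] {k : ℕ} {P : ℤ}
    (hP : ∀ n, 1 ≤ n → n ≤ k → (((PV d ℓ (mem n).m (mem n).K hd hL).sitesPerDir 0 : ℕ) : ℤ) = P)
    (hlev : ∀ n, 1 ≤ n → n ≤ k → ∀ z : SiteY (mem n), levY (mem n) z = n)
    (hG : G ≤ unitaryUnits (Matrix (Fin N) (Fin N) ℂ)) (hGa : AvgClosed (d + 1) (ℓ + 1) G)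
    {η : ℝ} (hη : 0 < η) {cL : ℝ} (hc3 : C0 (d + 1) * cL ≤ 1 / 3) (hc2 : 2 * cL ≤ c2' (d + 1) (ℓ + 1))
    {ι : Type} [Fintype ι] {b : Module.Basis ι ℝ (Matrix (Fin N) (Fin N) ℂ)} {M₂ δ₀ δ βx ρ A A₁ K c : ℝ} {d₁ : ℕ}
    (cst : KnitConstants b M₂ δ₀ δ βx ρ A A₁ K)
    {ιB : ∀ n, BlkY (mem n) → IBondY (mem n)} {Rr : ℝ} {Hp : Prop} {s : ℕ → ℝ}
    (maj : ∀ n, 1 ≤ n → n ≤ k → ∀ ⦃α₀ : ℝ⦄, 0 < α₀ → α₀ ≤ cL → ∀ U₀ : LSite (d + 1) → Fin (d + 1) → (Matrix (Fin N) (Fin N) ℂ)ˣ,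
      (∀ x κ, U₀ x κ ∈ G) → (∀ (x : LSite (d + 1)) (μ : Fin (d + 1)), U₀ (x + P • e μ) = U₀ x) →
      InAk (ℓ + 1) n η α₀ (fun _ => (Set.univ : Set (LSite (d + 1)))) U₀ →
      KnitMajorants (mem n) (bgY (mem n) U₀) b (ιB n) Rr Hp d₁ δ₀ δ βx ρ A A₁ K c (s n))
    {BG BR B₀'H B₂' B₀ B₀β cB β : ℝ} {len : LSite (d + 1) → ℝ}
    (hBG : (∑ j, ‖b j‖) * A * c * M₂ ≤ BG) (hBG₁ : (∑ j, ‖b j‖) * A₁ * c * M₂ ≤ BG)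
    (hBH : (∑ j, ‖b j‖) * (((M₂ * ∑ j, ‖b j‖) * A * A * K * B6.c1 d₁ δ₀ βx ^ 2) * c * M₂) ≤ B₀'H)
    (hBH₁ : (∑ j, ‖b j‖) * (((M₂ * ∑ j, ‖b j‖) * A₁ * A * K * B6.c1 d₁ δ₀ βx ^ 2) * c * M₂) ≤ B₀'H)
    (hB₂ : (∑ j, ‖b j‖) * (((M₂ * ∑ j, ‖b j‖) * A * K * B6.c1 d₁ δ₀ βx) * c * M₂)
        + (∑ j, ‖b j‖) * (((M₂ * ∑ j, ‖b j‖) * A * A * K * B6.c1 d₁ δ₀ βx ^ 2) * c * M₂) ≤ B₂')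
    (hBR : 1 + (∑ j, ‖b j‖) * (((M₂ * ∑ j, ‖b j‖) ^ 2 * A * K * A * B6.c1 d₁ δ₀ βx ^ 2) * c * M₂) ≤ BR)
    (hb9 : letI : CStarAlgebra (Matrix (Fin N) (Fin N) ℂ) := {}
      ∀ m, m ≤ k → ∀ ⦃α₀ : ℝ⦄, 0 < α₀ → α₀ ≤ cL → ∀ U₀ : LSite (d + 1) → Fin (d + 1) → (Matrix (Fin N) (Fin N) ℂ)ˣ,
        (∀ x κ, U₀ x κ ∈ G) → (∀ (x : LSite (d + 1)) (μ : Fin (d + 1)), U₀ (x + P • e μ) = U₀ x) →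
        InAk (ℓ + 1) m η α₀ (fun _ => (Set.univ : Set (LSite (d + 1)))) U₀ →
        B9P3PerAt (𝔸 := Matrix (Fin N) (Fin N) ℂ) (ℓ + 1) B₀ B₀β cB β len η m α₀ P U₀) :
    letI : CStarAlgebra (Matrix (Fin N) (Fin N) ℂ) := {}
    LettersAllPer (𝔸 := Matrix (Fin N) (Fin N) ℂ) (ℓ + 1) BG BR B₀'H B₂' B₀ B₀β cB β len cL η k P G :=
  lettersAllPer_ofParKnitY mem hP hlev hG hGa hη.ne' hc3 hc2
    (knitEstimates_familyAt_of_majorants mem hP hlev hG hGa hη hc3 hc2 cst maj hBG hBG₁ hBH hBH₁ hB₂ hBR hb9)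

/-- ★★★★★ **[B8] THM 2 ON `T_η` FOR `SU(N)` (`N ≤ 25`), ITS LANDAU-GAUGE LETTERS BEING [4]'s OPERATORS AT PRINT's TRANSPORTERS, FROM THE DISPLAYED BLOCK MAJORANTS.**
The G-B8-T2S endpoint `B8Thm2TorusAtOfLettersPerB9.thm2TorusAt_specialUnitary_of_lettersPerB9` composed with files A2–A4: uniform `B₂, c₁ > 0` such that for every
`k ≥ 1`, `η > 0`, `P ∈ LᵏZ` — GIVEN (i) a catalogue `memF k P n` of constant-level-`n` members of the k-level family on the torus of side `P` (with their finite block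
geometries), (ii) for every member and every `SU(N)`-valued `P`-periodic `U₀ ∈ 𝔄_n(T_η, α₀)`, `α₀ ≤ c_L`, the [4] Thm 3.1∕3.2-type block majorants of `η_S²G′(U₀)`,
`η_S⁻¹∇_μ·η_S²G′(U₀)`, `s(Q′G′²Q′*)⁻¹(U₀)` at print's transporters with the uniform constants `KnitConstants` (M5.5∕M5.6's output shapes), (iii) the (B)-lines
(Prop. 3's in-edge (1.59), M5.7–8), (iv) the trace laws of the letters — `Thm2TorusAt (ℓ+1) k P η 0 B₁ B₂ c₁ len SU(N) ⊤` holds; with the endpoint's numeric windows,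
`c_L` below [B7] Prop. 2's thresholds, and `B_G, B₀′ᴴ, B₂′, B_R` above the four explicit expressions in `Σ‖b_j‖, M₂, A, A₁, K, c₁, c`.  HONEST SCOPE: (i)–(iv)
displayed, none inhabited here; count-neutral; `stub_PV3A` NOT discharged; nothing continuum ∕ ℝ⁴ ∕ OS ∕ mass-gap ∕ Clay — the Yang–Mills mass gap is NOT proved.
[cite: Balaban1985RegularSpaces, Thm 2 p.83, Thm 4 p.88, (1.7) p.77, p.76, p.77 («Ω_j = T_η»), (1.91)–(1.98) pp.91–92, (1.101) p.93, (1.59) p.86; Balaban1985BackgroundPropagators, Thm 3.1 (3.42) p.397, Thm 3.2 (3.48) p.398, (3.19)–(3.25) pp.393–395, Thm 3.11 p.416; Balaban1985Averaging, Prop. 2 p.26; Balaban1984PropagatorsII, (2.51)–(2.52) p.232, (2.61) p.234] -/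
theorem thm2TorusAt_specialUnitary_ofMajorants (hN : N ≤ 25) (hd2 : 2 ≤ d + 1)
    {B₀ B₀' B₀'H B₂' BG BR B₀β cB9 β cL B₁ : ℝ} {len : LSite (d + 1) → ℝ}
    (hB₀ : 0 < B₀) (hB₀' : 0 < B₀') (hB : 2 ≤ 5 * ((d + 1 : ℕ) : ℝ) * ((ℓ + 1 : ℕ) : ℝ) * B₀) (hB₀'H : 0 < B₀'H) (hB₂' : 0 ≤ B₂') (hBG : 0 ≤ BG)
    (hBR : 0 ≤ BR) (hcB9 : 0 < cB9) (hcL : 0 < cL) (hfree : 3 * (2 * ((d + 1 : ℕ) : ℝ) * (((ℓ + 1 : ℕ) : ℝ)) ^ 2) * BG * (BR + 2) ≤ B₀')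
    (hB₁ : 5 * ((d + 1 : ℕ) : ℝ) * ((ℓ + 1 : ℕ) : ℝ) * B₀ * (1 + 11 * (((d + 1 : ℕ) : ℝ)) ^ 2) < B₁)
    (hc3 : C0 (d + 1) * cL ≤ 1 / 3) (hc2 : 2 * cL ≤ c2' (d + 1) (ℓ + 1))
    {ι : Type} [Fintype ι] {b : Module.Basis ι ℝ (Matrix (Fin N) (Fin N) ℂ)} {M₂ δ₀ δ βx ρ A A₁ K c : ℝ} {d₁ : ℕ}
    (cst : KnitConstants b M₂ δ₀ δ βx ρ A A₁ K)
    (hBGe : (∑ j, ‖b j‖) * A * c * M₂ ≤ BG) (hBG₁ : (∑ j, ‖b j‖) * A₁ * c * M₂ ≤ BG)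
    (hBH : (∑ j, ‖b j‖) * (((M₂ * ∑ j, ‖b j‖) * A * A * K * B6.c1 d₁ δ₀ βx ^ 2) * c * M₂) ≤ B₀'H)
    (hBH₁ : (∑ j, ‖b j‖) * (((M₂ * ∑ j, ‖b j‖) * A₁ * A * K * B6.c1 d₁ δ₀ βx ^ 2) * c * M₂) ≤ B₀'H)
    (hB₂ : (∑ j, ‖b j‖) * (((M₂ * ∑ j, ‖b j‖) * A * K * B6.c1 d₁ δ₀ βx) * c * M₂)
        + (∑ j, ‖b j‖) * (((M₂ * ∑ j, ‖b j‖) * A * A * K * B6.c1 d₁ δ₀ βx ^ 2) * c * M₂) ≤ B₂')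
    (hBRe : 1 + (∑ j, ‖b j‖) * (((M₂ * ∑ j, ‖b j‖) ^ 2 * A * K * A * B6.c1 d₁ δ₀ βx ^ 2) * c * M₂) ≤ BR)
    (memF : ℕ → ℤ → ℕ → KIdx d ℓ hd hL b₀ b₁) [∀ k P n, Fintype (geo9K (memF k P n)).Site] [∀ k P n, DecidableEq (geo9K (memF k P n)).Site]
    (ιBF : ∀ k P n, BlkY (memF k P n) → IBondY (memF k P n)) (Rr : ℝ) (Hp : Prop) (sF : ℕ → ℤ → ℕ → ℝ) :
    letI : CStarAlgebra (Matrix (Fin N) (Fin N) ℂ) := {}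
    ∃ B₂ c₁ : ℝ, 0 < B₂ ∧ 0 < c₁ ∧ ∀ (k : ℕ) (P : ℤ) (η : ℝ), 1 ≤ k → ∀ hη : 0 < η, (∃ M : ℤ, P = ((ℓ + 1 : ℕ) : ℤ) ^ k * M) →
      ∀ (hP : ∀ n, 1 ≤ n → n ≤ k → (((PV d ℓ (memF k P n).m (memF k P n).K hd hL).sitesPerDir 0 : ℕ) : ℤ) = P)
        (hlev : ∀ n, 1 ≤ n → n ≤ k → ∀ z : SiteY (memF k P n), levY (memF k P n) z = n),
        (∀ n, 1 ≤ n → n ≤ k → ∀ ⦃α₀ : ℝ⦄, 0 < α₀ → α₀ ≤ cL → ∀ U₀ : LSite (d + 1) → Fin (d + 1) → (Matrix (Fin N) (Fin N) ℂ)ˣ,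
            (∀ x κ, U₀ x κ ∈ specialUnitaryUnits (Fin N)) → (∀ (x : LSite (d + 1)) (μ : Fin (d + 1)), U₀ (x + P • e μ) = U₀ x) →
            InAk (ℓ + 1) n η α₀ (fun _ => (Set.univ : Set (LSite (d + 1)))) U₀ →
            KnitMajorants (memF k P n) (bgY (memF k P n) U₀) b (ιBF k P n) Rr Hp d₁ δ₀ δ βx ρ A A₁ K c (sF k P n)) →
        (∀ m, m ≤ k → ∀ ⦃α₀ : ℝ⦄, 0 < α₀ → α₀ ≤ cL → ∀ U₀ : LSite (d + 1) → Fin (d + 1) → (Matrix (Fin N) (Fin N) ℂ)ˣ,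
            (∀ x κ, U₀ x κ ∈ specialUnitaryUnits (Fin N)) → (∀ (x : LSite (d + 1)) (μ : Fin (d + 1)), U₀ (x + P • e μ) = U₀ x) →
            InAk (ℓ + 1) m η α₀ (fun _ => (Set.univ : Set (LSite (d + 1)))) U₀ →
            B9P3PerAt (𝔸 := Matrix (Fin N) (Fin N) ℂ) (ℓ + 1) B₀ B₀β cB9 β len η m α₀ P U₀) →
        (∀ (m : ℕ) (hm : m ≤ k) (α₀ : ℝ) (hα : 0 < α₀) (hc : α₀ ≤ cL) (U₀ : LSite (d + 1) → Fin (d + 1) → (Matrix (Fin N) (Fin N) ℂ)ˣ)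
            (hU₀G : ∀ x κ, U₀ x κ ∈ specialUnitaryUnits (Fin N)) (hU₀per : ∀ (x : LSite (d + 1)) (μ : Fin (d + 1)), U₀ (x + P • e μ) = U₀ x)
            (hA : InAk (ℓ + 1) m η α₀ (fun _ => (Set.univ : Set (LSite (d + 1)))) U₀),
            ∀ n (hn : 1 ≤ n) (hnm : n ≤ m), KnitLettersYTau (trCLM (Fin N))
              (knitLettersY_familyAt (memF k P) hP hlev specialUnitaryUnits_le_unitaryUnits (avgClosed_specialUnitary_of_le hN (d + 1) (ℓ + 1)) hη.ne'
                hc3 hc2 hm hα hc hU₀G hU₀per hA n hn hnm)) →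
      Thm2TorusAt (ℓ + 1) k P η 0 B₁ B₂ c₁ len (specialUnitaryUnits (Fin N)) (fun _ => True) := by
  letI : CStarAlgebra (Matrix (Fin N) (Fin N) ℂ) := {}
  obtain ⟨B₂, c₁, hB₂pos, hc₁, H⟩ :=
    thm2TorusAt_specialUnitary_of_lettersPerB9 (len := len) hN hd2 (L := ℓ + 1) hL.2 hB₀ hB₀' hB hB₀'H hB₂' hBG hBR hcB9 hcL hfree hB₁
  refine ⟨B₂, c₁, hB₂pos, hc₁, fun k P η hk hη hPk hP hlev hmaj hb9 hτ => ?_⟩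
  have est := knitEstimates_familyAt_of_majorants (memF k P) hP hlev specialUnitaryUnits_le_unitaryUnits
    (avgClosed_specialUnitary_of_le hN (d + 1) (ℓ + 1)) hη hc3 hc2 cst hmaj hBGe hBG₁ hBH hBH₁ hB₂ hBRe hb9
  exact H k P η hk hη hPk
    (lettersAllPer_ofParKnitY (memF k P) hP hlev specialUnitaryUnits_le_unitaryUnits (avgClosed_specialUnitary_of_le hN (d + 1) (ℓ + 1)) hη.ne' hc3 hc2 est)
    (lettersAllPerTau_ofParKnitY (trCLM (Fin N)) (memF k P) hP hlev specialUnitaryUnits_le_unitaryUnits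
      (avgClosed_specialUnitary_of_le hN (d + 1) (ℓ + 1)) hη.ne' hc3 hc2 est hτ)

end Binder

end Literature.MathematicalPhysics.QuantumFieldTheory.Balaban1983to89.B8Thm2TorusKnitEstimatesOfMajorants

end
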